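import Literature.Geometry.Kaehler.DeformationEquivalence
import HarnessLib

/-!
# A property of the fibres of a family which is locally constant along the base is constant over a
# connected base (the «open and closed» step of every deformation-invariance argument; PROVED)

Layer `Literature/Geometry/Kaehler`; companion of `DeformationEquivalence.lean` (Kodaira Def.
2.8–2.9: families `π : 𝒳 → B`, fibre identifications `IsFibreEmbedding X.model E𝒳 π b ι` of a
bundled complex manifold `X : ComplexManifold` with `π⁻¹(b)`).  The argument abstracted here is the
one by which Hassett–Tschinkel conclude Thm. 2.1 ("`Aut°(X)` is a deformation invariant of `X`,
i.e., there exists a local system of groups `Aut°(𝒳/B) → B` … such that for each `b' ∈ B` the fiber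
is isomorphic to `Aut°(X')`", arXiv:1004.0046 p. 3 L28–L36; tree:
`Geometry.Hyperkaehler.HassettTschinkel2013_holAutZero_localSystem.nonempty_mulEquiv`, where it is
carried out inline for `P X = (Aut°(X₀) ≅ Aut°(X))`), recorded once for every property `P` of
bundled complex manifolds: if every point `b₀` of the base has a neighbourhood `U` over which
`P(X) ↔ P(X₀)` for all fibre identifications `X ≅ π⁻¹(b)`, `b ∈ U`, `X₀ ≅ π⁻¹(b₀)`, and every fibre
admits an identification, then over a connected base `P` holds for one fibre iff it holds for any
other (`fibreProp_iff_of_locally_iff`).  Pure topology of the base: no holomorphy, no properness is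
used.  Consumer: `Geometry.Hyperkaehler.AutomorphismsLocalSystemFixedPoints` (fixed-point counts of
`Aut°` along a family — steps (ii)+(iii) of the print-synthesis record
`Literature.AlgebraicGeometry.Hyperkaehler.HassettTschinkel2013_Oguiso2020_fixedPointScheme_translation_kum4Type`
for one family).  Cross-ladder literature layer of ladder HodgeAV, rung H3 (cell `hodge-kum4`,
sub-home `lit-family`).  Everything proved; no definitions, no instances, no notation, NO named fact.

## Not here

The induction over chains of families (`IsDeformationEquivalent = EqvGen IsDeformationOf`): the
families of `IsDeformationOf` carry identifications of the two MARKED fibres only, so a property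
can be propagated along a chain only under an extra hypothesis providing identifications (and, for
the Hassett–Tschinkel input, irreducible symplectic structures) of ALL fibres — a Summits-side
decision, recorded as the «IHS-chain» gap of the cell.
-/

noncomputable section

open scoped Manifold ContDiff Topology
open Function Set Filter

universe u v

namespace Literature.Geometry.Kaehler

variable {E𝒳 : Type u} [NormedAddCommGroup E𝒳] [NormedSpace ℂ E𝒳]
  {𝒳 : Type u} [TopologicalSpace 𝒳] [ChartedSpace E𝒳 𝒳]
  {B : Type v} [TopologicalSpace B]

/-- One direction of `fibreProp_iff_of_locally_iff` (the clopen argument).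
[cite: HassettTschinkel2013, §2 Thm. 2.1 («for each b' ∈ B the fiber is isomorphic to Aut°(X')»: open-and-closed over the connected base)] -/
theorem fibreProp_of_locally_iff [ConnectedSpace B] {π : 𝒳 → B}
    (hfib : ∀ b : B, ∃ (X : ComplexManifold.{u}) (ι : X → 𝒳), IsFibreEmbedding X.model E𝒳 π b ι)
    (P : ComplexManifold.{u} → Prop)
    (hloc : ∀ (b₀ : B) (X₀ : ComplexManifold.{u}) (ι₀ : X₀ → 𝒳),
      IsFibreEmbedding X₀.model E𝒳 π b₀ ι₀ →
        ∃ U : Set B, IsOpen U ∧ b₀ ∈ U ∧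
          ∀ b ∈ U, ∀ (X : ComplexManifold.{u}) (ι : X → 𝒳),
            IsFibreEmbedding X.model E𝒳 π b ι → (P X ↔ P X₀))
    {s t : B} {X Y : ComplexManifold.{u}} {ι : X → 𝒳} {κ : Y → 𝒳}
    (hι : IsFibreEmbedding X.model E𝒳 π s ι) (hκ : IsFibreEmbedding Y.model E𝒳 π t κ)
    (hX : P X) : P Y := by
  classical
  -- `T` = points whose fibre satisfies `P` through SOME identification
  set T : Set B := {c | ∃ (Z : ComplexManifold.{u}) (μ : Z → 𝒳),
    IsFibreEmbedding Z.model E𝒳 π c μ ∧ P Z} with hTdef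
  have hsT : s ∈ T := ⟨X, ι, hι, hX⟩
  -- `T` is open
  have hTopen : IsOpen T := by
    rw [isOpen_iff_mem_nhds]
    rintro c ⟨Z, μ, hμ, hZ⟩
    obtain ⟨U, hUo, hcU, hU⟩ := hloc c Z μ hμ
    refine Filter.mem_of_superset (hUo.mem_nhds hcU) fun c' hc' => ?_
    obtain ⟨Z', μ', hμ'⟩ := hfib c'
    exact ⟨Z', μ', hμ', (hU c' hc' Z' μ' hμ').2 hZ⟩
  -- `T` is closed
  have hTclosed : IsClosed T := by
    rw [← closure_subset_iff_isClosed]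
    intro c hc
    obtain ⟨Z, μ, hμ⟩ := hfib c
    obtain ⟨U, hUo, hcU, hU⟩ := hloc c Z μ hμ
    obtain ⟨c', hc'U, hc'T⟩ := mem_closure_iff.1 hc U hUo hcU
    obtain ⟨Z', μ', hμ', hZ'⟩ := hc'T
    exact ⟨Z, μ, hμ, (hU c' hc'U Z' μ' hμ').1 hZ'⟩
  have hT : T = univ := IsClopen.eq_univ ⟨hTclosed, hTopen⟩ ⟨s, hsT⟩
  -- conclude at `t`: first for the witness identification, then for `κ`
  have htT : t ∈ T := hT ▸ mem_univ t
  obtain ⟨Z, μ, hμ, hZ⟩ := htT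
  obtain ⟨U, hUo, htU, hU⟩ := hloc t Y κ hκ
  exact (hU t htU Z μ hμ).1 hZ

/-- **A locally constant fibre property is constant over a connected base.**  Let `π : 𝒳 → B` have
connected base, every fibre admitting an identification `X ≅ π⁻¹(b)` with a bundled complex manifold
(`IsFibreEmbedding`), and let `P` be a property of bundled complex manifolds such that every
`b₀ ∈ B` with `X₀ ≅ π⁻¹(b₀)` has an open neighbourhood `U` with `P X ↔ P X₀` for all `X ≅ π⁻¹(b)`,
`b ∈ U`.  Then `P X ↔ P Y` for any two fibres `X ≅ π⁻¹(s)`, `Y ≅ π⁻¹(t)`.  (The open-and-closed step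
of «`P` is a deformation invariant», as in Hassett–Tschinkel's Thm. 2.1 for `P = (Aut° ≅ Aut°(X₀))`.)
[cite: HassettTschinkel2013, §2 Thm. 2.1 («for each b' ∈ B the fiber is isomorphic to Aut°(X')»: open-and-closed over the connected base)] -/
theorem fibreProp_iff_of_locally_iff [ConnectedSpace B] {π : 𝒳 → B}
    (hfib : ∀ b : B, ∃ (X : ComplexManifold.{u}) (ι : X → 𝒳), IsFibreEmbedding X.model E𝒳 π b ι)
    (P : ComplexManifold.{u} → Prop)
    (hloc : ∀ (b₀ : B) (X₀ : ComplexManifold.{u}) (ι₀ : X₀ → 𝒳),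
      IsFibreEmbedding X₀.model E𝒳 π b₀ ι₀ →
        ∃ U : Set B, IsOpen U ∧ b₀ ∈ U ∧
          ∀ b ∈ U, ∀ (X : ComplexManifold.{u}) (ι : X → 𝒳),
            IsFibreEmbedding X.model E𝒳 π b ι → (P X ↔ P X₀))
    {s t : B} {X Y : ComplexManifold.{u}} {ι : X → 𝒳} {κ : Y → 𝒳}
    (hι : IsFibreEmbedding X.model E𝒳 π s ι) (hκ : IsFibreEmbedding Y.model E𝒳 π t κ) :
    P X ↔ P Y :=
  ⟨fibreProp_of_locally_iff hfib P hloc hι hκ, fibreProp_of_locally_iff hfib P hloc hκ hι⟩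

end Literature.Geometry.Kaehler

end
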